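import Summits.ResolutionOfSingularities.ResolutionOfSingularities.Theorems.FrobeniusLadderFInjectiveMacaulayficationFedderViaSlicing
import Mathlib.RingTheory.Ideal.IsPrimary
import HarnessLib

/-!
# Fedder's test through a slicing — the extracted coefficient may carry a factor that is a unit only AT THE POINT
# (crux `FInjectiveMacaulayfication`; infrastructure for off-origin clauses along singular CURVES whose transversal Fedder
# witness has a base-dependent coefficient; campaign G_xz/5, RULING R15.14 (1) of res-L1-w45a-plan-1: «own file, citable by R6♭/FC″ hands»)

Support file for crux stmt-ResolutionOfSingularities-15315 (`FrobeniusLadder.FInjectiveMacaulayfication`), chain w45a, seat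
res-L1-w45a-stub-4 g6. [OURS · L1 W4.5a; variant of `FedderViaSlicing.clause_of_sliceCoeff` (res-L1-w45a-stub-3)] — NOT a statement of
the manuscript; AI-written, weaker than expert review.

`FedderViaSlicing.clause_of_sliceCoeff` reads ONE coefficient of `Ψ(F^{p-1})` (`Ψ : k[X] ≃+* B[Y]` a slicing, `Q` a maximal ideal of
`k[X]/(F)` containing the slice variables, `𝔭 = Q ∩ B` the base point) of the shape `u · φ^m`, `m ≤ p − 1`, and asks `u` to be a UNIT
OF `B`.  Along a singular curve the transversal Fedder witness typically has a coefficient `u` that is a polynomial in the base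
variables which is merely NON-ZERO AT THE POINT (`u ∉ 𝔭`) — e.g. `12·x²·φ³` along the cuspidal curve `C = {z = w = t = 0, φ = 0}`
(`x ≠ 0` there) of the `d = 4` specimen `G_xz` (`…GxzOffOrigin`).  `clause_of_sliceCoeff_of_not_mem` is the same certificate with
`(hu : u ∉ 𝔭)`: the Frobenius-power ideal `𝔭^{[p]} = (a_j^p)` has radical `𝔭`, a MAXIMAL ideal, so it is `𝔭`-PRIMARY
(`Ideal.isPrimary_of_isMaximal_radical`), and `u · φ^m ∈ 𝔭^{[p]}`, `u ∉ 𝔭 = √(𝔭^{[p]})` force `φ^m ∈ 𝔭^{[p]}`; the rest of the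
argument (Fedder read backwards on the regular base hypersurface `B_𝔭/(φ)`, or `φ ∉ 𝔭`) is verbatim.

All proofs are glue on Mathlib and landed files; no definitions, no named facts. References: [Fedder1983] R. Fedder, *F-purity and
rational singularity*, Trans. AMS 278 (1983), Thm. 1.12 (through the imported criterion). [folklore]
-/

-- single-problem summit: the doubled namespace component is forced
set_option linter.dupNamespace false

noncomputable section

namespace Summit.ResolutionOfSingularities.ResolutionOfSingularities.Theorems.FInjectiveMacaulayfication.FedderViaSlicingNotMem

open MvPolynomial IsLocalRing
open Summit.ResolutionOfSingularities.ResolutionOfSingularities.Theorems.FInjectiveMacaulayfication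

/-- In a commutative ring, if `(a_j)` is a maximal ideal `𝔭` then the Frobenius-type power ideal `(a_j^N)` (`0 < N`) is `𝔭`-primary:
a product `u · y ∈ (a_j^N)` with `u ∉ 𝔭` has `y ∈ (a_j^N)`. [folklore] -/
theorem mem_span_pow_of_mul_mem {B : Type*} [CommRing B] {m : ℕ} (a : Fin m → B) (N : ℕ) (hN : 0 < N)
    (h𝔭 : (Ideal.span (Set.range a)).IsMaximal) {u y : B} (hu : u ∉ Ideal.span (Set.range a))
    (huy : u * y ∈ Ideal.span (Set.range fun j => a j ^ N)) : y ∈ Ideal.span (Set.range fun j => a j ^ N) := by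
  have hrad : (Ideal.span (Set.range fun j => a j ^ N)).radical = Ideal.span (Set.range a) := by
    apply le_antisymm
    · refine (Ideal.radical_mono ?_).trans (le_of_eq h𝔭.isPrime.radical)
      rw [Ideal.span_le]
      rintro _ ⟨j, rfl⟩
      exact Ideal.pow_mem_of_mem _ (Ideal.subset_span (Set.mem_range_self j)) N hN
    · rw [Ideal.span_le]
      rintro _ ⟨j, rfl⟩
      exact ⟨N, Ideal.subset_span (Set.mem_range_self j)⟩
  have hprim : (Ideal.span (Set.range fun j => a j ^ N)).IsPrimary :=
    Ideal.isPrimary_of_isMaximal_radical (hrad.symm ▸ h𝔭)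
  rcases (Ideal.isPrimary_iff.mp hprim).2 (show y * u ∈ _ by rwa [mul_comm]) with hy | hu'
  · exact hy
  · exact absurd (hrad ▸ hu') hu

/-- **FEDDER'S TEST THROUGH A SLICING, coefficient with a point-unit factor.** `Ψ : k[X] ≃+* B[Y]` a slicing, `F ≠ 0`, `Q` a maximal
ideal of `k[X]/(F)` whose contraction contains the slice variables, `𝔭 = P ∩ B`; if the `Y^d`-coefficient (`d_s < p`) of `Ψ(F^{p-1})`
is `u·φ^m` with `u ∉ 𝔭` (a unit AT THE POINT only), `m ≤ p-1`, and either `φ ∉ 𝔭` or some `∂ᵢφ ∉ 𝔭`, then `(k[X]/(F))_Q` satisfies the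
Cohen–Macaulay + Frobenius-closed clause.  Same proof as `FedderViaSlicing.clause_of_sliceCoeff`, with `mem_span_pow_of_mul_mem`
(`𝔭^{[p]}` is `𝔭`-primary) replacing `Ideal.unit_mul_mem_iff_mem`. [cite: Fedder1983, Thm. 1.12] -/
theorem clause_of_sliceCoeff_of_not_mem (p : ℕ) [hp : Fact p.Prime] (k : Type) [Field k] [CharP k p] {n r r' : ℕ}
    (Ψ : MvPolynomial (Fin n) k ≃+* MvPolynomial (Fin r) (MvPolynomial (Fin r') k))
    (F : MvPolynomial (Fin n) k) (hF0 : F ≠ 0)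
    (Q : Ideal (MvPolynomial (Fin n) k ⧸ Ideal.span {F})) [Q.IsMaximal]
    (hy : ∀ s : Fin r, Ψ.symm (X s) ∈ Q.comap (Ideal.Quotient.mk (Ideal.span {F})))
    (d : Fin r →₀ ℕ) (hd : ∀ s, d s < p) (u φ : MvPolynomial (Fin r') k)
    (hu : u ∉ (Q.comap (Ideal.Quotient.mk (Ideal.span {F}))).comap (Ψ.symm.toRingHom.comp C)) (m : ℕ) (hm : m ≤ p - 1)
    (hcoeff : coeff d (Ψ (F ^ (p - 1))) = u * φ ^ m)
    (hφ : φ ∉ (Q.comap (Ideal.Quotient.mk (Ideal.span {F}))).comap (Ψ.symm.toRingHom.comp C) ∨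
      ∃ i : Fin r', pderiv i φ ∉ (Q.comap (Ideal.Quotient.mk (Ideal.span {F}))).comap (Ψ.symm.toRingHom.comp C)) :
    ∀ e : ℕ, ringKrullDim (Localization.AtPrime Q) = e → ∀ s : Fin e → Localization.AtPrime Q,
      (Ideal.span (Set.range s)).radical.IsMaximal →
        RingTheory.Sequence.IsWeaklyRegular (Localization.AtPrime Q) (List.ofFn s) ∧
        ∀ y : Localization.AtPrime Q, (∃ t : ℕ, y ^ p ^ t ∈ Ideal.span
          ((fun z : Localization.AtPrime Q => z ^ p ^ t) ''
            (Ideal.span (Set.range s) : Set (Localization.AtPrime Q)))) → y ∈ Ideal.span (Set.range s) := by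
  haveI hPmax : (Q.comap (Ideal.Quotient.mk (Ideal.span {F}))).IsMaximal :=
    Ideal.comap_isMaximal_of_surjective _ Ideal.Quotient.mk_surjective
  -- the base point and its generators
  haveI h𝔭 : ((Q.comap (Ideal.Quotient.mk (Ideal.span {F}))).comap (Ψ.symm.toRingHom.comp C)).IsMaximal :=
    CoordinateSlicing.comap_slice_isMaximal Ψ _ hy
  obtain ⟨m', a, ha⟩ := Submodule.fg_iff_exists_fin_generating_family.mp
    (IsNoetherian.noetherian ((Q.comap (Ideal.Quotient.mk (Ideal.span {F}))).comap (Ψ.symm.toRingHom.comp C)))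
  have hPA := CoordinateSlicing.eq_span_sliceFamily Ψ _ hy a ha
  refine FedderAtMaximalIdeal.stub_fedderAtMaximalIdeal p k n (r + m') _ F Q hPA hF0 ?_
  -- Fedder's test
  intro hmem
  have hext := CoordinateSlicing.coeff_mem_span_of_mem_span Ψ d p hd a hmem
  rw [hcoeff] at hext
  have ha' : Ideal.span (Set.range a) = (Q.comap (Ideal.Quotient.mk (Ideal.span {F}))).comap (Ψ.symm.toRingHom.comp C) := ha
  have h𝔭' : (Ideal.span (Set.range a)).IsMaximal := by rw [ha']; exact h𝔭
  have hu' : u ∉ Ideal.span (Set.range a) := by rw [ha']; exact hu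
  have hφm : φ ^ m ∈ Ideal.span (Set.range fun j => a j ^ p) :=
    mem_span_pow_of_mul_mem a p hp.out.pos h𝔭' hu' hext
  have h𝔞 : Ideal.span (Set.range fun j => a j ^ p) ≤
      (Q.comap (Ideal.Quotient.mk (Ideal.span {F}))).comap (Ψ.symm.toRingHom.comp C) := by
    rw [Ideal.span_le]
    rintro _ ⟨j, rfl⟩
    refine Ideal.pow_mem_of_mem _ ?_ p hp.out.pos
    rw [← ha]
    exact Ideal.subset_span (Set.mem_range_self j)
  have key : φ ∈ (Q.comap (Ideal.Quotient.mk (Ideal.span {F}))).comap (Ψ.symm.toRingHom.comp C) :=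
    h𝔭.isPrime.mem_of_pow_mem m (h𝔞 hφm)
  rcases hφ with hφ | ⟨i, hdi⟩
  · exact hφ key
  · -- the base hypersurface `B_𝔭/(φ)` is regular, hence clause-good; Fedder backwards
    have hφ0 : φ ≠ 0 := by
      intro h0
      apply hdi
      rw [h0, map_zero]
      exact Ideal.zero_mem _
    haveI hreg := HypersurfaceRegular.isRegularLocalRing_localization_quotient_of_pderiv_not_mem k r' φ i
      ((Q.comap (Ideal.Quotient.mk (Ideal.span {F}))).comap (Ψ.symm.toRingHom.comp C)) key hdi
    haveI : CharP (Localization.AtPrime ((Q.comap (Ideal.Quotient.mk (Ideal.span {F}))).comap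
        (Ψ.symm.toRingHom.comp C)) ⧸ Ideal.span {algebraMap (MvPolynomial (Fin r') k)
          (Localization.AtPrime ((Q.comap (Ideal.Quotient.mk (Ideal.span {F}))).comap (Ψ.symm.toRingHom.comp C))) φ}) p :=
      charP_of_injective_ringHom (((Ideal.Quotient.mk _).comp ((algebraMap (MvPolynomial (Fin r') k) _).comp
        (algebraMap k (MvPolynomial (Fin r') k)))).injective) p
    have hclause := (FiClauseOfRegular.stub_fiClauseOfRegular p (Localization.AtPrime ((Q.comap
      (Ideal.Quotient.mk (Ideal.span {F}))).comap (Ψ.symm.toRingHom.comp C)) ⧸ Ideal.span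
        {algebraMap (MvPolynomial (Fin r') k) (Localization.AtPrime ((Q.comap (Ideal.Quotient.mk
          (Ideal.span {F}))).comap (Ψ.symm.toRingHom.comp C))) φ})).2
    have hnot := (FedderAtMaximalIdeal.fedder_criterion_maximalIdeal k r' m' p
      ((Q.comap (Ideal.Quotient.mk (Ideal.span {F}))).comap (Ψ.symm.toRingHom.comp C)) a ha.symm φ key hφ0).mp hclause
    refine hnot ?_
    rw [← Nat.sub_add_cancel hm, pow_add]
    exact Ideal.mul_mem_left _ _ hφm

end Summit.ResolutionOfSingularities.ResolutionOfSingularities.Theorems.FInjectiveMacaulayfication.FedderViaSlicingNotMem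

end
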